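import Summits.QuantumFields.YangMills.Theorems.UnitScaleTiltProp7GreenEtaTJBlockDecayOfLetters
import Summits.QuantumFields.YangMills.Theorems.UnitScaleTiltProp7OneFormGreenBlockColumn
import HarnessLib

/-!
# Route `UnitScaleTilt`, crux K1 «MinimiserStabilityRegPr» (stmt-QuantumFields-19200), EX row (7) `hCk` — **THE BLOCK-`ℓ¹` COLUMN `hGcol` OF `G_S = (Δ^η + T_J + DR_SD* + Q_k†aQ_k)⁻¹`
# AT THE UN-PROJECTED J-SLOT, BY DUALITY FROM THE BLOCK-SUPPORTED SUP ROW (F)** — px16 g13's (K2-L1) duality ✓`Prop7OneFormGreenBlockColumn.sum_norm_symm_apply_single_le_of_isSymmetric`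
# composed with ✓(F) `Prop7GreenEtaTJBlockDecayOfLetters.hGblk_etaTJ_of_letters`; the `hGcol` input of the C-door ✓`Prop7KernelCDoorOfKinvEntry.kernelC_family_of_kinvRow_of_greenColumn` at
# `Δx := DeltaEtaSlot + T_J` (★p1 g28 CHAIR LOCATE №45, WORD №46 (4)).  [Balaban1985BackgroundPropagators] Thm 3.3 (3.46)–(3.49): «the `ℓ⁻³` of `C_k` is the block-`L¹` column of `G`
# composed with `Q_k`'s average, not a pointwise `ℓ⁻³` row».

Cell `ym3-torus` (HUMAN RULING D-0037; rung R3 = SU(2) YM₃ on T³ — NOT d = 4, NOT infinite volume, NOT a mass gap, NOT Clay).  Fleet lead ∕ chair seat `ym-ust-19200-p1` (gen 28).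
THEOREMS ONLY (0 `def`, 0 `sorry`); `--supports stmt-QuantumFields-19200 --as helper`; count-neutral.

THE MATHEMATICS.  `G_S` is symmetric on the class when the slot is (`Δ^η` ✓`DeltaEta_isSymmetric` + a symmetric `T_J`, ✓`GT_isSymmetric`); for a symmetric operator the block-`ℓ¹` column
`Σ_{bd ∈ B(y)} ‖(G δ_b⊗Z)(bd)‖` is, by duality against block-supported Frobenius-normalised test fields, at most `2c‖Z‖` where `c` bounds `‖(G X)(b)‖` over `X ⊂ B(y)`, `‖X‖ ≤ 1` — and that
`c` is (F)'s block-supported row at `s := 1`: `c = 2BV·e^{−δ·tdist(B b₋, y)}`.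

WHAT IS PROVED (ns `…Theorems.Prop7GreenEtaTJBlockColumn`).
* ★★★ **`blockColumn_GT_etaTJ_of_letters`** — on `PosOnto(η) ∧ PosOnto(S)`, `T_J(U₀)` symmetric (`hTsymm`), (F)'s weighted letters `hGw hTw` (`∀ z`) and window `BV·CT ≤ ½`:
  `∀ b Z y, Σ_{bd : B bd₋ = y} ‖toL2⁻¹(G_S(toL2(δ_b ⊗ Z))) bd‖ ≤ (2·(2BV))·e^{−δ·tdist(y, B b₋)}·‖Z‖` — the C-door's `hGcol` binder text at `Δx := DeltaEtaSlot + TJ`, `C_G := 4BV` (K-free shape).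
HYP-SAT (★★OWNER RULING №42).  As (F): `hGw` ⟸ px16 (Gb)-families ∘ ✓`weighted_of_blockSupported`; `hTw` ⟸ px12 T1 ∘ px19 ✓`hTw_of_supRow`; `hTsymm` ⟸ the slot's reality∕symmetry rows
(as ✓`DeltaOneP_isSymmetric (hTsymm)` displays it); PosOnto(S) ⟸ px12 T2; non-vacuous schemas; no `Prop` placeholder.
HONEST SCOPE.  One duality step over landed lemmas; nothing of hKinv(S_J), `hCk`, the other EX rows, EX or the crux is proved here; the Yang–Mills mass gap is NOT proved.

References: T. Bałaban, CMP **99** (1985) 389–434 [Balaban1985BackgroundPropagators] (Thm 3.3 (3.46)–(3.49) pp.398–399, (3.10)–(3.12) p.392, Thm 3.12 p.422); CMP **102** (1985) 277–309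
[Balaban1985Variational] ((110)–(111) p.294, (133) p.298).
-/

set_option autoImplicit false

noncomputable section

open scoped Matrix.Norms.L2Operator BigOperators InnerProductSpace ComplexConjugate

namespace Summit.QuantumFields.YangMills.Theorems.Prop7GreenEtaTJBlockColumn

open Literature.MathematicalPhysics.QuantumFieldTheory.Balaban1983to89
open Literature.MathematicalPhysics.QuantumFieldTheory.Balaban1983to89.T3ContinuumYM3Torus
open B5Eq118OneStroke (iterBlockOf)
open B9Eq311L2Pairing (WL2)
open B11Eq103H1Complex (SiteL2K BondL2K)
open Summit.QuantumFields.YangMills.Theorems.Prop7SectET3Transport (periodsT3)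
open Summit.QuantumFields.YangMills.Theorems.Prop7SectET3HilbertLetters (W₂ toL2)
open Summit.QuantumFields.YangMills.Theorems.Prop7SectET3WilsonHessian (DeltaEta DeltaEtaSlot DeltaEta_isSymmetric)
open Summit.QuantumFields.YangMills.Theorems.Prop7SectET3CurvedPropagators (PosOnto GT)
open Summit.QuantumFields.YangMills.Theorems.Prop7SectET3OpsT3HilbertRows (GT_isSymmetric)
open Summit.QuantumFields.YangMills.Theorems.Prop7BlockDistanceWeights (tdist_coarse_comm)
open Summit.QuantumFields.YangMills.Theorems.Prop7OneFormGreenBlockColumn (sum_norm_symm_apply_single_le_of_isSymmetric)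
open Summit.QuantumFields.YangMills.Theorems.Prop7GreenEtaTJBlockDecayOfLetters (hGblk_etaTJ_of_letters)

variable {F : T3Family} {n K : ℕ} {h : n ≤ K} {c₀ cB a : ℝ} [Fact (0 < c₀)] [Fact (0 < cB)]
  (TJ : GaugeField (F.P K) 0 (Matrix.specialUnitaryGroup (Fin 2) ℂ) → (BondL2K ℂ 3 (periodsT3 F K) c₀ W₂ →ₗ[ℂ] BondL2K ℂ 3 (periodsT3 F K) c₀ W₂))

/-- The slot `Δ^η + T_J` is symmetric at `U₀` when `T_J(U₀)` is (✓`DeltaEta_isSymmetric`). [cite: Balaban1985BackgroundPropagators, (3.10)–(3.12) p.392] -/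
theorem etaTJ_slot_isSymmetric (U₀ : GaugeField (F.P K) 0 (Matrix.specialUnitaryGroup (Fin 2) ℂ)) (hTsymm : (TJ U₀).IsSymmetric) :
    ((DeltaEtaSlot F n K c₀ + TJ) U₀).IsSymmetric := by
  rw [Pi.add_apply]
  exact (DeltaEta_isSymmetric (F := F) (n := n) (K := K) (c₀ := c₀) U₀).add hTsymm

/-- ★★★ **THE BLOCK-`ℓ¹` COLUMN OF `G_S` AT THE SLOT `Δ^η + T_J` — the C-door's `hGcol` binder text** (`C_G := 2·(2BV)`, rate `δ`): duality (✓`sum_norm_symm_apply_single_le_of_isSymmetric`)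
over (F)'s block-supported row at `s := 1`. [cite: Balaban1985BackgroundPropagators, Thm 3.3 (3.46)–(3.49) pp.398–399, Thm 3.12 p.422; Balaban1985Variational, (110) p.294] -/
theorem blockColumn_GT_etaTJ_of_letters {δ : ℝ} (U₀ : GaugeField (F.P K) 0 (Matrix.specialUnitaryGroup (Fin 2) ℂ))
    (hp₀ : PosOnto F n K h c₀ cB a (DeltaEtaSlot F n K c₀) U₀) (hpS : PosOnto F n K h c₀ cB a (DeltaEtaSlot F n K c₀ + TJ) U₀)
    (hTsymm : (TJ U₀).IsSymmetric)
    {BV CT : ℝ} (hBV : 0 ≤ BV) (hCT : 0 ≤ CT)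
    (hGw : ∀ (z : Site (F.P K) (K - n)) (Y : PBond (F.P K) 0 → Matrix (Fin 2) (Fin 2) ℂ) (m : ℝ), 0 ≤ m →
      (∀ b, ‖Y b‖ ≤ m * Real.exp (-(δ * (Site.tdist (iterBlockOf (K - n) b.src) z : ℝ)))) →
      ∀ bd, ‖(toL2 F K c₀).symm (GT F n K h c₀ cB a (DeltaEtaSlot F n K c₀) U₀ (toL2 F K c₀ Y)) bd‖
        ≤ BV * m * Real.exp (-(δ * (Site.tdist (iterBlockOf (K - n) bd.src) z : ℝ))))
    (hTw : ∀ (z : Site (F.P K) (K - n)) (Y : PBond (F.P K) 0 → Matrix (Fin 2) (Fin 2) ℂ) (m : ℝ), 0 ≤ m →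
      (∀ b, ‖Y b‖ ≤ m * Real.exp (-(δ * (Site.tdist (iterBlockOf (K - n) b.src) z : ℝ)))) →
      ∀ bd, ‖(toL2 F K c₀).symm (TJ U₀ (toL2 F K c₀ Y)) bd‖ ≤ CT * m * Real.exp (-(δ * (Site.tdist (iterBlockOf (K - n) bd.src) z : ℝ))))
    (hwin : BV * CT ≤ 1 / 2) :
    ∀ (b : PBond (F.P K) 0) (Z : Matrix (Fin 2) (Fin 2) ℂ) (y : Site (F.P K) (K - n)),
      ∑ bd ∈ Finset.univ.filter (fun bd : PBond (F.P K) 0 => iterBlockOf (K - n) bd.src = y),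
          ‖(toL2 F K c₀).symm (GT F n K h c₀ cB a (DeltaEtaSlot F n K c₀ + TJ) U₀ (toL2 F K c₀ (Pi.single b Z))) bd‖
        ≤ (2 * (2 * BV)) * Real.exp (-(δ * (Site.tdist (P := F.P K) y (iterBlockOf (K - n) b.src) : ℝ))) * ‖Z‖ := by
  classical
  intro b Z y
  have hsym := GT_isSymmetric (h := h) (cB := cB) (a := a) hpS (etaTJ_slot_isSymmetric TJ U₀ hTsymm)
  have hblk := hGblk_etaTJ_of_letters (h := h) (cB := cB) (a := a) TJ U₀ hp₀ hpS hBV hCT hGw hTw hwin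
  have h1 := sum_norm_symm_apply_single_le_of_isSymmetric (GT F n K h c₀ cB a (DeltaEtaSlot F n K c₀ + TJ) U₀) hsym
    (Finset.univ.filter (fun bd : PBond (F.P K) 0 => iterBlockOf (K - n) bd.src = y)) b
    (c := 1 * (2 * BV) * Real.exp (-(δ * (Site.tdist (P := F.P K) (iterBlockOf (K - n) b.src) y : ℝ))))
    (fun X hXS hX1 => hblk X y (fun bd hbd => (Finset.mem_filter.mp (hXS bd hbd)).2) 1 zero_le_one hX1 b) Z
  rw [tdist_coarse_comm F y (iterBlockOf (K - n) b.src)]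
  calc _ ≤ _ := h1
    _ = _ := by ring

end Summit.QuantumFields.YangMills.Theorems.Prop7GreenEtaTJBlockColumn

end
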